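import Summits.ABC.Harvest.CalibrationFloors
import Literature.NumberTheory.DiophantineGeometry.MinimalDiscriminantFactorizationProofs
import Mathlib.Analysis.Complex.ExponentialBounds
import HarnessLib

/-!
# Route PlacewiseSzpiro — crux `SingleTowerSzpiro` (stmt-ABC-22410): FIXED-PRIME FLOORS, kernel-certified

Negative lane of the crux X1 = `Summit.ABC.ABC.Theses.PlacewiseSzpiro.SingleTowerSzpiro` («every finite tower
`ord_p(Δ_min(E)) · log p` is at most `(6+ε) log N_E + C(ε)`»), filed `--supports stmt-ABC-22410` by the refuter /
engine seat abc-harv-eng-2 (parcel ENG-PLACE-1-FIXEDP, answering the line lead's «disprover-wanted: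
stub_multiplicativeTower at FIXED small p»). PROOF-ONLY file (no `def`, no `sorry`, no new axiom, no named-fact
hypothesis); it does NOT refute the crux (X1 follows from Szpiro `6+ε`, `singleTowerSzpiro_of_szpiroConjecture`):
it refutes the EXPLICIT-CONSTANT members of the X1 family that the Cremona census says are already dead, from ONE
record datum each, by exact integer arithmetic in the kernel — the pattern of
`Summit.ABC.Harvest.not_polySzpiroRatEff_zero_of_le` (`CalibrationFloors.lean`). A floor refutes an over-sharp
constant ONLY; it says nothing about X1 with its free constant `C(ε)`. HONESTY (D-0139/D-0140): abc is not proved by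
any of this; X1 is open; A-PS is NOT abc — «NOT abc — POLY-SZPIRO(E)»; typed ≠ proved; computed ≠ proved — which is
why the two record towers are THEOREMS here, not table look-ups.

WHAT IS KERNEL. Both record curves are SEMISTABLE with a minimal integer model `W₀`, `gcd(Δ(W₀), c₄(W₀)) = 1`, so
the tree gives `N = rad Δ` (`BurungaleSkinner2023.conductorNorm_baseChange_int_of_isCoprime`, Silverman ATAEC
IV.10.2) and `|Δ_min| = |Δ(W₀)|` (`Summit.ABC.Harvest.minimalDiscriminantNorm_baseChange_int_of_isCoprime`, AEC
VII.1 Rem. 1.1, VIII.8); the single tower is read off through `|Δ_min| = ∏_p p ^ ord_p(Δ_min)`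
(`WeierstrassCurve.factorization_minimalDiscriminantNorm_holds`, AEC VIII.8).

| § | datum (Cremona label, minimal model) | tower | floor proved here |
|---|---|---|---|
| 1–2 | `32658b1 = [1,1,0,214938418885,−3196409689114997607]`, `N = 32658 = 2·3·5443`, `Δ = −2²·3⁷⁴·5443` | `p = 3`, `ord₃ Δ_min = 74`, `74 log 3 − 6 log N = 18.934…`, `74 log 3 / log N = 7.8216…` | exponent `6`: every admissible constant exceeds `18.93`; `6.1`: `> 17.8`; `6.5`: `> 13.7`; `7`: `> 8.5`; constant `0`: exponent `> 7.82` |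
| 3–4 | `858k2 = [1,0,0,16353089,−335543012233]`, `N = 858 = 2·3·11·13`, `Δ = −2·3²·11·13²¹` | `p = 13`, `ord₁₃ Δ_min = 21`, `21 log 13 − 6 log N = 13.336…`, `21 log 13 / log N = 7.9744…` (the record single-tower RATIO for `N < 5·10⁵`) | constant `0`: every admissible exponent exceeds `7.974`; exponent `6` at `p = 13`: constant `> 13.33` |

Companion file `FixedPrimeFloorsTwoSevenEleven.lean` (same seat): the record SEMISTABLE towers at `p = 2, 7, 11`
(`910e3`, `75229d1`, `1870h2`; floors an order of magnitude weaker: constants `> 2.78 / 2.68 / 2.75`).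

Data source: J. E. Cremona, *ecdata* (curves of conductor `< 500000`), labels `32658b1`, `858k2`; census
DESK-CALIB-2 (kit j290396) and ENG-PLACE-1-FIXEDP (kit j293510) of cell abc-harv. The census numbers are
CALIBRATIONS, not proofs; only the rows above are kernel facts.
References: [cite: SilvermanAEC2009, VII.1 Rem. 1.1, VII.5 Prop. 5.1, VIII.8]; [cite: Silverman1994, IV.10.2];
[cite: Cremona1997, Table 1 (conventions for a-invariants, N, Δ)].
-/

noncomputable section

-- `Summit.<Summit>.<Problem>` is the mandated summit-side namespace (CONVENTIONS §2); for the
-- single-conjunct summit `ABC` the two coincide, so the duplicate `ABC.ABC` is deliberate.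
set_option linter.dupNamespace false

namespace Summit.ABC.ABC.Theorems

namespace SingleTowerSzpiroFloors

open Real WeierstrassCurve IsDedekindDomain
open Literature.NumberTheory.EllipticCurves
open Rat.HeightOneSpectrum

/-- `5443` is prime. [folklore] -/
theorem prime_5443 : Nat.Prime 5443 := by norm_num

/-- `13` is prime. [folklore] -/
theorem prime_13 : Nat.Prime 13 := by norm_num

/-! ## §0 Generic: one tower kills every explicit (exponent, constant) pair below it -/

/-- **One tower kills every explicit pair below it**: if some elliptic `E/ℚ` and finite place `v` have
`K · log N_E + C < ord_v(Δ_min(E)) · log p_v`, then the explicit-constant single-tower bound with exponent `K` and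
constant `C` is false. [folklore] -/
theorem not_singleTowerBound_of_lt {W : WeierstrassCurve ℚ} (hW : W.IsElliptic) (v : HeightOneSpectrum ℤ)
    {K C : ℝ}
    (h : K * Real.log (W.conductorNorm ℤ : ℝ) + C <
      (W.ordMinimalDiscriminant v : ℝ) * Real.log (natGenerator v : ℝ)) :
    ¬ (∀ (W : WeierstrassCurve ℚ) [W.IsElliptic] (v : HeightOneSpectrum ℤ),
        (W.ordMinimalDiscriminant v : ℝ) * Real.log (natGenerator v : ℝ) ≤
          K * Real.log (W.conductorNorm ℤ : ℝ) + C) := by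
  intro hKC
  have h1 := @hKC W hW v
  linarith

/-- **Kernel form of a tower inequality**: `K log N + C < n log p` follows from the integer-exponent
inequality `N^a · 2.7182818286^b < p^{s n}` once `s K ≤ a` and `s C ≤ b` (`s ≥ 1`), via `e < 2.7182818286`
(`Real.exp_one_lt_d9`). [folklore] -/
theorem lt_tower_of_pow_mul_pow_lt {N p n s a b : ℕ} (hN : 0 < N) (hp : 0 < p) (hs : 0 < s) {K C : ℝ}
    (hK : (s : ℝ) * K ≤ a) (hC : (s : ℝ) * C ≤ b)
    (h : (N : ℝ) ^ a * (2.7182818286 : ℝ) ^ b < (p : ℝ) ^ (s * n)) :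
    K * Real.log (N : ℝ) + C < (n : ℝ) * Real.log (p : ℝ) := by
  have hN1 : (1 : ℝ) ≤ (N : ℝ) := by exact_mod_cast hN
  have hNr : (0 : ℝ) < (N : ℝ) := by exact_mod_cast hN
  have hpr : (0 : ℝ) < (p : ℝ) := by exact_mod_cast hp
  have hsr : (0 : ℝ) < (s : ℝ) := by exact_mod_cast hs
  have hlogN : 0 ≤ Real.log (N : ℝ) := Real.log_nonneg hN1
  have h1 : (s : ℝ) * K * Real.log (N : ℝ) ≤ (a : ℝ) * Real.log (N : ℝ) :=
    mul_le_mul_of_nonneg_right hK hlogN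
  have h2 : Real.exp ((a : ℝ) * Real.log (N : ℝ) + (b : ℝ)) <
      Real.exp (((s * n : ℕ) : ℝ) * Real.log (p : ℝ)) := by
    rw [Real.exp_add, Real.exp_nat_mul, Real.exp_log hNr, Real.exp_nat_mul, Real.exp_log hpr,
      ← Real.exp_one_pow]
    calc (N : ℝ) ^ a * Real.exp 1 ^ b ≤ (N : ℝ) ^ a * (2.7182818286 : ℝ) ^ b := by
          gcongr
          exact Real.exp_one_lt_d9.le
      _ < (p : ℝ) ^ (s * n) := h
  have h3 := Real.exp_lt_exp.mp h2
  have h4 : ((s * n : ℕ) : ℝ) * Real.log (p : ℝ) = (s : ℝ) * ((n : ℝ) * Real.log (p : ℝ)) := by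
    push_cast; ring
  have h5 : (s : ℝ) * (K * Real.log (N : ℝ) + C) < (s : ℝ) * ((n : ℝ) * Real.log (p : ℝ)) := by
    rw [← h4]
    calc (s : ℝ) * (K * Real.log (N : ℝ) + C) = (s : ℝ) * K * Real.log (N : ℝ) + (s : ℝ) * C := by ring
      _ ≤ (a : ℝ) * Real.log (N : ℝ) + (b : ℝ) := add_le_add h1 hC
      _ < ((s * n : ℕ) : ℝ) * Real.log (p : ℝ) := h3
  exact lt_of_mul_lt_mul_left h5 hsr.le

/-! ## §1 Cremona `32658b1`, certified in the kernel: `N = 32658`, `|Δ_min| = 2²·3⁷⁴·5443`, `ord₃ Δ_min = 74`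
-/

/-- `Δ(32658b1) = −2²·3⁷⁴·5443 = −4414394834031741347651253295765949458668` (kernel arithmetic).
[cite: Cremona1997, Table 1] -/
theorem c32658b1_Δ :
    (⟨1, 1, 0, 214938418885, -3196409689114997607⟩ : WeierstrassCurve ℤ).Δ =
      -4414394834031741347651253295765949458668 := by
  norm_num [WeierstrassCurve.Δ, WeierstrassCurve.b₂, WeierstrassCurve.b₄, WeierstrassCurve.b₆,
    WeierstrassCurve.b₈]

/-- `c₄(32658b1) = −10317044106455`. [cite: Cremona1997, Table 1] -/
theorem c32658b1_c₄ :
    (⟨1, 1, 0, 214938418885, -3196409689114997607⟩ : WeierstrassCurve ℤ).c₄ = -10317044106455 := by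
  norm_num [WeierstrassCurve.c₄, WeierstrassCurve.b₂, WeierstrassCurve.b₄]

/-- `32658b1` is elliptic (`Δ ≠ 0`). [cite: Cremona1997, Table 1] -/
theorem c32658b1_isElliptic :
    ((⟨1, 1, 0, 214938418885, -3196409689114997607⟩ : WeierstrassCurve ℤ).baseChange ℚ).IsElliptic :=
  Literature.NumberTheory.EllipticCurves.isElliptic_baseChange_int _ (by rw [c32658b1_Δ]; norm_num)

/-- `Δ` and `c₄` of `32658b1` are coprime: the curve is semistable and the model minimal.
[cite: SilvermanAEC2009, VII.5 Prop. 5.1(b)] -/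
theorem c32658b1_isCoprime :
    IsCoprime (⟨1, 1, 0, 214938418885, -3196409689114997607⟩ : WeierstrassCurve ℤ).Δ
      (⟨1, 1, 0, 214938418885, -3196409689114997607⟩ : WeierstrassCurve ℤ).c₄ := by
  rw [c32658b1_Δ, c32658b1_c₄, Int.isCoprime_iff_gcd_eq_one]
  decide

/-- **`N(32658b1) = 32658 = 2·3·5443`** — a THEOREM (semistable case of Tate's algorithm, tree).
[cite: Silverman1994, IV.10.2] -/
theorem c32658b1_conductorNorm :
    ((⟨1, 1, 0, 214938418885, -3196409689114997607⟩ : WeierstrassCurve ℤ).baseChange ℚ).conductorNorm ℤ = 32658 := by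
  haveI := c32658b1_isElliptic
  refine BurungaleSkinner2023.conductorNorm_baseChange_int_of_isCoprime _ c32658b1_isCoprime (k := 74)
    ?_ ?_ ?_
  · rw [show (32658 : ℕ) = 2 * (3 * 5443) by norm_num]
    exact Nat.squarefree_mul_iff.mpr ⟨by norm_num, (show Nat.Prime 2 by norm_num).prime.squarefree,
      Nat.squarefree_mul_iff.mpr ⟨by norm_num, Nat.prime_three.prime.squarefree,
        prime_5443.prime.squarefree⟩⟩
  · rw [c32658b1_Δ]; norm_num
  · rw [c32658b1_Δ]; norm_num

/-- **`|Δ_min(32658b1)| = 2²·3⁷⁴·5443`** — a THEOREM (minimal model). [cite: SilvermanAEC2009, VIII.8] -/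
theorem c32658b1_minimalDiscriminantNorm :
    ((⟨1, 1, 0, 214938418885, -3196409689114997607⟩ : WeierstrassCurve ℤ).baseChange ℚ).minimalDiscriminantNorm ℤ =
      4414394834031741347651253295765949458668 := by
  rw [Summit.ABC.Harvest.minimalDiscriminantNorm_baseChange_int_of_isCoprime c32658b1_isElliptic
    c32658b1_isCoprime, c32658b1_Δ]
  norm_num

/-- **`ord₃ Δ_min(32658b1) = 74`** — the record `3`-tower below conductor `5·10⁵`, a THEOREM
(`|Δ_min| = 3⁷⁴ · 21772`, `3 ∤ 21772`). [cite: SilvermanAEC2009, VIII.8] -/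
theorem c32658b1_ordMinimalDiscriminant_three :
    ((⟨1, 1, 0, 214938418885, -3196409689114997607⟩ : WeierstrassCurve ℤ).baseChange ℚ).ordMinimalDiscriminant
      ((primesEquiv (R := ℤ)).symm ⟨3, Nat.prime_three⟩) = 74 := by
  have h := WeierstrassCurve.factorization_minimalDiscriminantNorm_holds
    ((⟨1, 1, 0, 214938418885, -3196409689114997607⟩ : WeierstrassCurve ℤ).baseChange ℚ)
    ((primesEquiv (R := ℤ)).symm ⟨3, Nat.prime_three⟩)
  rw [Rat.natGenerator_primesEquiv_symm, c32658b1_minimalDiscriminantNorm] at h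
  rw [← h, show (4414394834031741347651253295765949458668 : ℕ) = 3 ^ 74 * 21772 by norm_num,
    Nat.factorization_mul (by positivity) (by norm_num), Finsupp.add_apply,
    Nat.Prime.factorization_pow Nat.prime_three, Finsupp.single_eq_same,
    Nat.factorization_eq_zero_of_not_dvd (by norm_num : ¬ 3 ∣ 21772)]

/-- The `3`-tower of `32658b1` in kernel form: `K · log 32658 + C < 74 · log 3` whenever
`32658^a · 2.7182818286^b < 3^{74 s}`, `s K ≤ a`, `s C ≤ b`. [folklore] -/
theorem c32658b1_lt_tower {K C : ℝ} {s a b : ℕ} (hs : 0 < s) (hK : (s : ℝ) * K ≤ a) (hC : (s : ℝ) * C ≤ b)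
    (h : (32658 : ℝ) ^ a * (2.7182818286 : ℝ) ^ b < (3 : ℝ) ^ (s * 74)) :
    K * Real.log (((⟨1, 1, 0, 214938418885, -3196409689114997607⟩ : WeierstrassCurve ℤ).baseChange
          ℚ).conductorNorm ℤ : ℝ) + C <
      (((⟨1, 1, 0, 214938418885, -3196409689114997607⟩ : WeierstrassCurve ℤ).baseChange ℚ).ordMinimalDiscriminant
          ((primesEquiv (R := ℤ)).symm ⟨3, Nat.prime_three⟩) : ℝ) *
        Real.log (natGenerator ((primesEquiv (R := ℤ)).symm ⟨3, Nat.prime_three⟩) : ℝ) := by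
  rw [c32658b1_conductorNorm, c32658b1_ordMinimalDiscriminant_three, Rat.natGenerator_primesEquiv_symm]
  have := lt_tower_of_pow_mul_pow_lt (N := 32658) (p := 3) (n := 74) (by norm_num) (by norm_num) hs hK hC
    (by exact_mod_cast h)
  exact_mod_cast this

/-! ## §2 Floors from the `3`-tower of `32658b1` (exponent `6 + ε`, ε ∈ {0, 0.1, 0.5, 1}; constant `0`) -/

set_option exponentiation.threshold 100000 in
/-- **FLOOR (p = 3, exponent 6): the single-tower bound `ord_p(Δ_min) log p ≤ 6 log N + C` is FALSE for every
`C ≤ 18.93`** (`32658b1`: `74 log 3 − 6 log 32658 = 18.934…`). The `ε = 0` member is outside X1 (which asks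
`ε > 0`); this is the calibration of its constant. [folklore] -/
theorem not_singleTowerBound_six_of_le {C : ℝ} (hC : C ≤ 18.93) :
    ¬ (∀ (W : WeierstrassCurve ℚ) [W.IsElliptic] (v : HeightOneSpectrum ℤ),
        (W.ordMinimalDiscriminant v : ℝ) * Real.log (natGenerator v : ℝ) ≤
          6 * Real.log (W.conductorNorm ℤ : ℝ) + C) :=
  not_singleTowerBound_of_lt c32658b1_isElliptic ((primesEquiv (R := ℤ)).symm ⟨3, Nat.prime_three⟩)
    (c32658b1_lt_tower (s := 100) (a := 600) (b := 1893) (by norm_num) (by norm_num)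
      (by push_cast; linarith) (by norm_num))

set_option exponentiation.threshold 100000 in
/-- **FLOOR (X1 at ε = 0.1): every constant `C` admissible in `SingleTowerSzpiro` at `ε = 0.1` exceeds `17.8`**
(`32658b1`: `74 log 3 − 6.1 log 32658 = 17.894…`). [folklore] -/
theorem singleTowerSzpiro_constant_floor_tenth {C : ℝ}
    (h : ∀ (W : WeierstrassCurve ℚ) [W.IsElliptic] (v : HeightOneSpectrum ℤ),
        (W.ordMinimalDiscriminant v : ℝ) * Real.log (natGenerator v : ℝ) ≤
          (6 + 0.1) * Real.log (W.conductorNorm ℤ : ℝ) + C) :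
    17.8 < C := by
  by_contra hC
  push Not at hC
  exact not_singleTowerBound_of_lt c32658b1_isElliptic ((primesEquiv (R := ℤ)).symm ⟨3, Nat.prime_three⟩)
    (c32658b1_lt_tower (s := 10) (a := 61) (b := 178) (by norm_num) (by norm_num)
      (by push_cast; linarith) (by norm_num)) h

set_option exponentiation.threshold 100000 in
/-- **FLOOR (X1 at ε = 0.5): every admissible constant exceeds `13.7`** (`32658b1`:
`74 log 3 − 6.5 log 32658 = 13.737…`). [folklore] -/
theorem singleTowerSzpiro_constant_floor_half {C : ℝ}
    (h : ∀ (W : WeierstrassCurve ℚ) [W.IsElliptic] (v : HeightOneSpectrum ℤ),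
        (W.ordMinimalDiscriminant v : ℝ) * Real.log (natGenerator v : ℝ) ≤
          (6 + 0.5) * Real.log (W.conductorNorm ℤ : ℝ) + C) :
    13.7 < C := by
  by_contra hC
  push Not at hC
  exact not_singleTowerBound_of_lt c32658b1_isElliptic ((primesEquiv (R := ℤ)).symm ⟨3, Nat.prime_three⟩)
    (c32658b1_lt_tower (s := 10) (a := 65) (b := 137) (by norm_num) (by norm_num)
      (by push_cast; linarith) (by norm_num)) h

set_option exponentiation.threshold 100000 in
/-- **FLOOR (X1 at ε = 1): every admissible constant exceeds `8.5`** (`32658b1`: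
`74 log 3 − 7 log 32658 = 8.540…`). [folklore] -/
theorem singleTowerSzpiro_constant_floor_one {C : ℝ}
    (h : ∀ (W : WeierstrassCurve ℚ) [W.IsElliptic] (v : HeightOneSpectrum ℤ),
        (W.ordMinimalDiscriminant v : ℝ) * Real.log (natGenerator v : ℝ) ≤
          (6 + 1) * Real.log (W.conductorNorm ℤ : ℝ) + C) :
    8.5 < C := by
  by_contra hC
  push Not at hC
  exact not_singleTowerBound_of_lt c32658b1_isElliptic ((primesEquiv (R := ℤ)).symm ⟨3, Nat.prime_three⟩)
    (c32658b1_lt_tower (s := 10) (a := 70) (b := 85) (by norm_num) (by norm_num)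
      (by push_cast; linarith) (by norm_num)) h

/-! ## §3 Cremona `858k2`, certified in the kernel: `N = 858`, `|Δ_min| = 2·3²·11·13²¹`, `ord₁₃ Δ_min = 21`
-/

/-- `Δ(858k2) = −2·3²·11·13²¹ = −48918776756543177755473774` (kernel arithmetic).
[cite: Cremona1997, Table 1] -/
theorem c858k2_Δ :
    (⟨1, 0, 0, 16353089, -335543012233⟩ : WeierstrassCurve ℤ).Δ = -48918776756543177755473774 := by
  norm_num [WeierstrassCurve.Δ, WeierstrassCurve.b₂, WeierstrassCurve.b₄, WeierstrassCurve.b₆,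
    WeierstrassCurve.b₈]

/-- `c₄(858k2) = −784948271`. [cite: Cremona1997, Table 1] -/
theorem c858k2_c₄ : (⟨1, 0, 0, 16353089, -335543012233⟩ : WeierstrassCurve ℤ).c₄ = -784948271 := by
  norm_num [WeierstrassCurve.c₄, WeierstrassCurve.b₂, WeierstrassCurve.b₄]

/-- `858k2` is elliptic (`Δ ≠ 0`). [cite: Cremona1997, Table 1] -/
theorem c858k2_isElliptic :
    ((⟨1, 0, 0, 16353089, -335543012233⟩ : WeierstrassCurve ℤ).baseChange ℚ).IsElliptic :=
  Literature.NumberTheory.EllipticCurves.isElliptic_baseChange_int _ (by rw [c858k2_Δ]; norm_num)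

/-- `Δ` and `c₄` of `858k2` are coprime: the curve is semistable and the model minimal.
[cite: SilvermanAEC2009, VII.5 Prop. 5.1(b)] -/
theorem c858k2_isCoprime :
    IsCoprime (⟨1, 0, 0, 16353089, -335543012233⟩ : WeierstrassCurve ℤ).Δ
      (⟨1, 0, 0, 16353089, -335543012233⟩ : WeierstrassCurve ℤ).c₄ := by
  rw [c858k2_Δ, c858k2_c₄, Int.isCoprime_iff_gcd_eq_one]
  decide

/-- **`N(858k2) = 858 = 2·3·11·13`** — a THEOREM (semistable case of Tate's algorithm, tree).
[cite: Silverman1994, IV.10.2] -/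
theorem c858k2_conductorNorm :
    ((⟨1, 0, 0, 16353089, -335543012233⟩ : WeierstrassCurve ℤ).baseChange ℚ).conductorNorm ℤ = 858 := by
  haveI := c858k2_isElliptic
  refine BurungaleSkinner2023.conductorNorm_baseChange_int_of_isCoprime _ c858k2_isCoprime (k := 21)
    ?_ ?_ ?_
  · rw [show (858 : ℕ) = 2 * (3 * (11 * 13)) by norm_num]
    exact Nat.squarefree_mul_iff.mpr ⟨by norm_num, (show Nat.Prime 2 by norm_num).prime.squarefree,
      Nat.squarefree_mul_iff.mpr ⟨by norm_num, Nat.prime_three.prime.squarefree,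
        Nat.squarefree_mul_iff.mpr ⟨by norm_num, (show Nat.Prime 11 by norm_num).prime.squarefree,
          prime_13.prime.squarefree⟩⟩⟩
  · rw [c858k2_Δ]; norm_num
  · rw [c858k2_Δ]; norm_num

/-- **`|Δ_min(858k2)| = 2·3²·11·13²¹`** — a THEOREM (minimal model). [cite: SilvermanAEC2009, VIII.8] -/
theorem c858k2_minimalDiscriminantNorm :
    ((⟨1, 0, 0, 16353089, -335543012233⟩ : WeierstrassCurve ℤ).baseChange ℚ).minimalDiscriminantNorm ℤ =
      48918776756543177755473774 := by
  rw [Summit.ABC.Harvest.minimalDiscriminantNorm_baseChange_int_of_isCoprime c858k2_isElliptic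
    c858k2_isCoprime, c858k2_Δ]
  norm_num

/-- **`ord₁₃ Δ_min(858k2) = 21`** — a THEOREM (`|Δ_min| = 13²¹ · 198`, `13 ∤ 198`).
[cite: SilvermanAEC2009, VIII.8] -/
theorem c858k2_ordMinimalDiscriminant_thirteen :
    ((⟨1, 0, 0, 16353089, -335543012233⟩ : WeierstrassCurve ℤ).baseChange ℚ).ordMinimalDiscriminant
      ((primesEquiv (R := ℤ)).symm ⟨13, prime_13⟩) = 21 := by
  have h := WeierstrassCurve.factorization_minimalDiscriminantNorm_holds
    ((⟨1, 0, 0, 16353089, -335543012233⟩ : WeierstrassCurve ℤ).baseChange ℚ)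
    ((primesEquiv (R := ℤ)).symm ⟨13, prime_13⟩)
  rw [Rat.natGenerator_primesEquiv_symm, c858k2_minimalDiscriminantNorm] at h
  rw [← h, show (48918776756543177755473774 : ℕ) = 13 ^ 21 * 198 by norm_num,
    Nat.factorization_mul (by positivity) (by norm_num), Finsupp.add_apply,
    Nat.Prime.factorization_pow prime_13, Finsupp.single_eq_same,
    Nat.factorization_eq_zero_of_not_dvd (by norm_num : ¬ 13 ∣ 198)]

/-- The `13`-tower of `858k2` in kernel form: `K · log 858 + C < 21 · log 13` whenever
`858^a · 2.7182818286^b < 13^{21 s}`, `s K ≤ a`, `s C ≤ b`. [folklore] -/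
theorem c858k2_lt_tower {K C : ℝ} {s a b : ℕ} (hs : 0 < s) (hK : (s : ℝ) * K ≤ a) (hC : (s : ℝ) * C ≤ b)
    (h : (858 : ℝ) ^ a * (2.7182818286 : ℝ) ^ b < (13 : ℝ) ^ (s * 21)) :
    K * Real.log (((⟨1, 0, 0, 16353089, -335543012233⟩ : WeierstrassCurve ℤ).baseChange ℚ).conductorNorm ℤ : ℝ) + C <
      (((⟨1, 0, 0, 16353089, -335543012233⟩ : WeierstrassCurve ℤ).baseChange ℚ).ordMinimalDiscriminant
          ((primesEquiv (R := ℤ)).symm ⟨13, prime_13⟩) : ℝ) *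
        Real.log (natGenerator ((primesEquiv (R := ℤ)).symm ⟨13, prime_13⟩) : ℝ) := by
  rw [c858k2_conductorNorm, c858k2_ordMinimalDiscriminant_thirteen, Rat.natGenerator_primesEquiv_symm]
  have := lt_tower_of_pow_mul_pow_lt (N := 858) (p := 13) (n := 21) (by norm_num) (by norm_num) hs hK hC
    (by exact_mod_cast h)
  exact_mod_cast this

/-! ## §4 Floors from the `13`-tower of `858k2` (constant `0`; exponent `6` at the fixed prime `13`) -/

set_option exponentiation.threshold 100000 in
/-- **FLOOR (constant 0): the constant-free single-tower bound `ord_p(Δ_min) log p ≤ K log N` is FALSE for every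
`K ≤ 7.974`** (`858k2`: `21 log 13 / log 858 = 7.97440…`, the record single-tower ratio below conductor `5·10⁵`;
cf. the whole-discriminant record ratio `9.0199…`, `Summit.ABC.Harvest.bennettYazdani_szpiroRatio_enclosure`).
[folklore] -/
theorem not_singleTowerBound_zero_of_le {K : ℝ} (hK : K ≤ 7.974) :
    ¬ (∀ (W : WeierstrassCurve ℚ) [W.IsElliptic] (v : HeightOneSpectrum ℤ),
        (W.ordMinimalDiscriminant v : ℝ) * Real.log (natGenerator v : ℝ) ≤
          K * Real.log (W.conductorNorm ℤ : ℝ) + 0) :=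
  not_singleTowerBound_of_lt c858k2_isElliptic ((primesEquiv (R := ℤ)).symm ⟨13, prime_13⟩)
    (c858k2_lt_tower (s := 1000) (a := 7974) (b := 0) (by norm_num) (by push_cast; linarith) (by norm_num)
      (by norm_num))

set_option exponentiation.threshold 100000 in
/-- **FLOOR (p = 13, exponent 6): `ord₁₃(Δ_min) log 13 ≤ 6 log N + C` is FALSE for every `C ≤ 13.33`**
(`858k2`: `21 log 13 − 6 log 858 = 13.336…`) — the fixed-prime floor at `p = 13`; the fixed-prime floor at
`p = 3` is `not_singleTowerBound_six_of_le`. [folklore] -/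
theorem not_singleTowerBound_six_at_thirteen_of_le {C : ℝ} (hC : C ≤ 13.33) :
    ¬ (∀ (W : WeierstrassCurve ℚ) [W.IsElliptic] (v : HeightOneSpectrum ℤ),
        natGenerator v = 13 →
        (W.ordMinimalDiscriminant v : ℝ) * Real.log (natGenerator v : ℝ) ≤
          6 * Real.log (W.conductorNorm ℤ : ℝ) + C) := by
  intro hKC
  have h1 := @hKC _ c858k2_isElliptic ((primesEquiv (R := ℤ)).symm ⟨13, prime_13⟩)
    (Rat.natGenerator_primesEquiv_symm _)
  have h2 := c858k2_lt_tower (K := 6) (C := C) (s := 100) (a := 600) (b := 1333) (by norm_num) (by norm_num)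
    (by push_cast; linarith) (by norm_num)
  linarith

set_option exponentiation.threshold 100000 in
/-- **FLOOR (p = 3, exponent 6, fixed-prime form): `ord₃(Δ_min) log 3 ≤ 6 log N + C` is FALSE for every
`C ≤ 18.93`.** [folklore] -/
theorem not_singleTowerBound_six_at_three_of_le {C : ℝ} (hC : C ≤ 18.93) :
    ¬ (∀ (W : WeierstrassCurve ℚ) [W.IsElliptic] (v : HeightOneSpectrum ℤ),
        natGenerator v = 3 →
        (W.ordMinimalDiscriminant v : ℝ) * Real.log (natGenerator v : ℝ) ≤
          6 * Real.log (W.conductorNorm ℤ : ℝ) + C) := by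
  intro hKC
  have h1 := @hKC _ c32658b1_isElliptic ((primesEquiv (R := ℤ)).symm ⟨3, Nat.prime_three⟩)
    (Rat.natGenerator_primesEquiv_symm _)
  have h2 := c32658b1_lt_tower (K := 6) (C := C) (s := 100) (a := 600) (b := 1893) (by norm_num) (by norm_num)
    (by push_cast; linarith) (by norm_num)
  linarith

/-- **Summary of the two headline floors** (exponent `6` needs constant `> 18.93`; constant `0` needs exponent
`> 7.974`). X1 itself is implied by Szpiro `6+ε` (`singleTowerSzpiro_of_szpiroConjecture`), so no finite census
refutes it without refuting Szpiro; the floors calibrate its constant only. [folklore] -/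
theorem singleTowerSzpiro_floor_summary :
    (¬ ∀ (W : WeierstrassCurve ℚ) [W.IsElliptic] (v : HeightOneSpectrum ℤ),
        (W.ordMinimalDiscriminant v : ℝ) * Real.log (natGenerator v : ℝ) ≤
          6 * Real.log (W.conductorNorm ℤ : ℝ) + 18.93) ∧
    (¬ ∀ (W : WeierstrassCurve ℚ) [W.IsElliptic] (v : HeightOneSpectrum ℤ),
        (W.ordMinimalDiscriminant v : ℝ) * Real.log (natGenerator v : ℝ) ≤
          7.974 * Real.log (W.conductorNorm ℤ : ℝ) + 0) :=
  ⟨not_singleTowerBound_six_of_le le_rfl, not_singleTowerBound_zero_of_le le_rfl⟩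

end SingleTowerSzpiroFloors

end Summit.ABC.ABC.Theorems

end
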